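import Mathlib
import HarnessLib

/-!
# Forward differences of a `C²` function are bounded by its derivatives: `‖Δ_δ f‖ ≤ δ sup ‖f′‖`, `‖Δ_δ² f‖ ≤ δ² sup ‖f″‖`

Topic `Literature/Analysis`; the elementary bridge between the DISCRETE differences of a lattice symbol that is the restriction of a
smooth function (a single-scale propagator symbol sampled at the Matsubara frequencies `π(2n+1)/β` or at the torus momenta `2πk/L`) and
the derivatives of that function (mean value inequality, applied twice): for `f : ℝ → E` with `E` a real normed space,

* `norm_sub_le_of_norm_deriv_le` — `‖f(x+δ) - f(x)‖ ≤ δ·B` if `‖f′‖ ≤ B` on `[x, x+δ]`;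
* **`norm_second_difference_le`** — `‖f(x+2δ) - 2f(x+δ) + f(x)‖ ≤ δ²·B` if `f′` is differentiable with `‖f″‖ ≤ B` on `[x, x+2δ]`;
* `norm_fwdDiff_iter_two_le` — the same for `(fwdDiff δ)^[2] f x`.

This is the input of the weighted-Plancherel `L¹` bounds with second differences (Benfatto–Giuliani–Mastropietro 2006, (2.36aa): discrete
derivatives of the slice symbols at finite `(β, L)` are controlled by continuum derivatives; cell gate-hubbard-kl, R0-SCOPE-4 W2c).

Everything is proved; no definitions, no named facts.

## Sources

G. Benfatto, A. Giuliani, V. Mastropietro, Ann. Henri Poincaré 7 (2006) 809–898, (2.36aa) and footnote ¹ (`BenfattoGiulianiMastropietro2006`).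
-/

noncomputable section

open Set

namespace Literature.Analysis

variable {E : Type*} [NormedAddCommGroup E] [NormedSpace ℝ E]

/-- **Mean value inequality on `[x, x+δ]`**: `‖f(x+δ) - f(x)‖ ≤ δ B` when `f` has derivative `f′` with `‖f′‖ ≤ B` on the segment.
[cite: BenfattoGiulianiMastropietro2006, (2.36aa)] -/
theorem norm_sub_le_of_norm_deriv_le {f f' : ℝ → E} {x δ B : ℝ} (hδ : 0 ≤ δ)
    (hf : ∀ t ∈ Icc x (x + δ), HasDerivAt f (f' t) t) (hB : ∀ t ∈ Icc x (x + δ), ‖f' t‖ ≤ B) :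
    ‖f (x + δ) - f x‖ ≤ δ * B := by
  have h := norm_image_sub_le_of_norm_deriv_le_segment' (fun t ht => (hf t ht).hasDerivWithinAt)
    (fun t ht => hB t (Ico_subset_Icc_self ht)) (x + δ) (right_mem_Icc.2 (by linarith))
  simpa only [add_sub_cancel_left] using h.trans (le_of_eq (by ring))

/-- **The second difference is bounded by the second derivative**: if `f` has derivative `f′` and `f′` has derivative `f″` on
`[x, x+2δ]` with `‖f″‖ ≤ B` there, then `‖f(x+2δ) - 2 f(x+δ) + f(x)‖ ≤ δ² B` (`δ ≥ 0`).
[cite: BenfattoGiulianiMastropietro2006, (2.36aa)] -/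
theorem norm_second_difference_le {f f' f'' : ℝ → E} {x δ B : ℝ} (hδ : 0 ≤ δ)
    (hf : ∀ t ∈ Icc x (x + 2 * δ), HasDerivAt f (f' t) t) (hf' : ∀ t ∈ Icc x (x + 2 * δ), HasDerivAt f' (f'' t) t)
    (hB : ∀ t ∈ Icc x (x + 2 * δ), ‖f'' t‖ ≤ B) :
    ‖f (x + 2 * δ) - (2 : ℝ) • f (x + δ) + f x‖ ≤ δ ^ 2 * B := by
  -- `ψ(t) = f(t+δ) - f(t)` has derivative `f′(t+δ) - f′(t)`, of norm `≤ δ B` on `[x, x+δ]`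
  set ψ : ℝ → E := fun t => f (t + δ) - f t with hψ
  have hψ' : ∀ t ∈ Icc x (x + δ), HasDerivAt ψ (f' (t + δ) - f' t) t := by
    intro t ht
    have h1 : HasDerivAt (fun s => f (s + δ)) (f' (t + δ)) t := by
      have := (hf (t + δ) ⟨by linarith [ht.1], by linarith [ht.2]⟩).comp_add_const t δ
      simpa using this
    exact h1.sub (hf t ⟨ht.1, by linarith [ht.2]⟩)
  have hψB : ∀ t ∈ Icc x (x + δ), ‖f' (t + δ) - f' t‖ ≤ δ * B := by
    intro t ht
    exact norm_sub_le_of_norm_deriv_le (f := f') hδ (fun s hs => hf' s ⟨by linarith [hs.1, ht.1], by linarith [hs.2, ht.2]⟩)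
      fun s hs => hB s ⟨by linarith [hs.1, ht.1], by linarith [hs.2, ht.2]⟩
  have hmain := norm_sub_le_of_norm_deriv_le (f := ψ) hδ hψ' hψB
  have hid : ψ (x + δ) - ψ x = f (x + 2 * δ) - (2 : ℝ) • f (x + δ) + f x := by
    simp only [hψ, two_smul]
    rw [show x + δ + δ = x + 2 * δ by ring]
    abel
  rw [← hid]
  exact hmain.trans (le_of_eq (by ring))

/-- The same for the iterated forward difference `(fwdDiff δ)^[2] f x = f(x+2δ) - 2f(x+δ) + f(x)`.
[cite: BenfattoGiulianiMastropietro2006, (2.36aa)] -/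
theorem norm_fwdDiff_iter_two_le {f f' f'' : ℝ → E} {x δ B : ℝ} (hδ : 0 ≤ δ)
    (hf : ∀ t ∈ Icc x (x + 2 * δ), HasDerivAt f (f' t) t) (hf' : ∀ t ∈ Icc x (x + 2 * δ), HasDerivAt f' (f'' t) t)
    (hB : ∀ t ∈ Icc x (x + 2 * δ), ‖f'' t‖ ≤ B) :
    ‖(fwdDiff δ)^[2] f x‖ ≤ δ ^ 2 * B := by
  have h2 : (fwdDiff δ)^[2] f x = f (x + 2 * δ) - (2 : ℝ) • f (x + δ) + f x := by
    simp only [Function.iterate_succ, Function.iterate_zero, Function.comp_apply, Function.id_def, fwdDiff, two_smul]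
    rw [show x + δ + δ = x + 2 * δ by ring]
    abel
  rw [h2]
  exact norm_second_difference_le hδ hf hf' hB

end Literature.Analysis

end
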